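import Summits.HodgeConjecture.HodgeConjecture.Theorems.HCCMUnconditionalOfGenericFloorV7
import Summits.HodgeConjecture.HodgeConjecture.Theorems.HCCMUnconditionalH413OfFacts
import Summits.HodgeConjecture.CorCM.Hyp413.A3Liu413FaceTypes
import Literature.NumberTheory.GelbartRogawski1991.OscillatorTripleExistenceAndOccurrence
import Literature.NumberTheory.Automorphic.HeckeFixedVectorsLift
import Literature.NumberTheory.Automorphic.Liu2021.Def411AsPrinted
import Mathlib.RepresentationTheory.Intertwining
import Summits.HodgeConjecture.HodgeConjecture.Theorems.H413CohFormsCarriers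
import Literature.NumberTheory.Automorphic.AdelicUnitaryGroupSpectrum
import HarnessLib

/-!
# Crux `H413` — **SPECTRUM INTERFACES** (floor 0, programmes P2 ∕ P3 ∕ P4): the generic [Liu2021, 4.13]-datum shapes, the `L²` junction at the carriers,
# the stub TYPES of the P2 line of record and of its `L²` cut, the P4 theta-road letter type, and the kernel-checked split heads — typed ONCE, zero `sorry`,
# so that the crux lines `P2ThetaDictionaryExists` ∕ `F0-P2CohSpectrumL2` ∕ `F0-P4AdmissibleOccursInH1` ∕ `F0-U3CohMultOne` IMPORT instead of pasting.

HC_CM is proved only modulo the 7 printed citations until rung 0 closes.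

ROLE (director s341 «ONE CURRENCY with P2», 2026-08-30T21:16Z; F0P2-plan PLAN brief #0).  This is a DEF-lane helper module for crux item
`stmt-HodgeConjecture-24833` (`HCCMUnconditional.H413`): it proves no stub and consumes no named fact.  Contents:
* §0 the three binder types of floor V7 (`HdictEType`, `HJ3aType`, `HoccType`) with their `Iff.rfl` links to `datum413` (A-p18 (g15), line of record v3 §0);
* §2 the generic shapes over a `Prop413Data` (A-p18 (g15), v3 §2 VERBATIM: `IsGlobalEps`, `HeckeRelatedAt`, `OccursIn`, `RealisedIn`, `SpectrumIsThetaAtLevel`,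
  `OmegaIrreducibleOrZero`, `HeckeLevelRigidity` + the closed link `heckeLevelRigidity_of_omegaIrreducibleOrZero`, `OccurringGlobalThetaIsAdmissible`,
  `occursIn_of_realisedIn`, `dictionaryExistence_of_parts`) and the cut's `OccursInSomePart` ∕ `spectrumIsThetaAtLevel_of_parts` (F0P2-plan);
* §2b the `L²` junction (F0P2-plan): `quotMk`, `Represents 𝔞 μ ℓ`, `cotPart` ∕ `holPart` ∕ `antiholPart 𝔞 μ ℓ Π` for a discrete automorphic `Π ≤ L²(U(V)(F⁺)\U(V)(𝔸), μ)`
  (★ `Literature.NumberTheory.Automorphic.DiscreteAutomorphicRep`, ★ `AdelicGroupData.IsAutomorphicMeasure`), lattice lemmas, `mem_cotPart_iff`;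
* §3 the stub TYPES of the P2 line of record at the pin (`StubU1RealisationAt`, `StubU2CohFormsSpectrumIsThetaAt`, `StubU4SignRule`, v3 VERBATIM) and the closed
  `omegaIrreducibleOrZero_datum413` (★ `H411_proof`); §3b the three stub types of the `L²` cut (`StubU2lL2Realisation`, `StubU2aSpectralProjection`,
  `StubE2E2bCotPartSpectrumIsTheta` = the ENGINE LETTER consumed by P2, [Rogawski1990, 13.3.6 (c)] + [GelbartRogawski1991, 5.1.1 ∕ 5.1.2] direction ⇒);
* §3d the P4 theta-road letter type `StubT3aHolThetaRealisationAt` (F0P4-plan (g0) line `F0-P4AdmissibleOccursInH1` 98373f7d760ea57a, VERBATIM) =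
  [GelbartRogawski1991, 5.1.1] direction ⇐ + Rallis non-vanishing [Li1992, 2.1] — the OTHER direction of the same printed dictionary; P2 never consumes it;
* §4 the kernel-checked heads as hypotheses-explicit theorems (no `sorry`): `stubU2_of : U2ℓ → U2a → E2E2b → U2′`,
  `oscillatorTriple_dictionaryExistence_holds_of : U1′ → U2′ → U4 → HdictEType` (A-p18 (g15) head, VERBATIM), `…_holds_of_split`, and
  `H413_of_split : U1′ → U2ℓ → U2a → E2E2b → U4 → HJ3aType → HoccType → HCCMUnconditional.H413` (BY NAME).
A crux line then reads `theorem stub_X : SpectrumInterfaces.StubX := by sorry` per registered stub and `theorem H413_of_stubs := SpectrumInterfaces.H413_of_split stub_… …`.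

Boxed by F0P2-plan (g0) 2026-08-30 (HOME `F0/P2/H413SpectrumInterfaces.BOXED.F0P2g0.lean`); filing is the typer's (`--supports stmt-HodgeConjecture-24833 --as helper`).
The sub-line docstring of `F0-P2CohSpectrumL2` (design, sources, page hits) applies verbatim and is not repeated here.
-/



/-! **EDITION NOTE (split, courier A-p18 (g15) on F0P2-plan (g0)'s GO 2026-08-30T21:57:48Z):** this module is the DEFINITIONS-ONLY half (floor types, generic shapes,
`L²` junction carriers, all `Stub…` TYPES); every `theorem` of the boxed single-file version 2a65bff7073aefd5 (kernel composition, `cotPart` lemmas, heads) lives in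
`Theorems/H413SpectrumInterfacesKernel.lean`, same namespace.  Decl texts unchanged. -/

set_option autoImplicit false

-- the mandated namespace has the single-problem summit's repeated segment (`HodgeConjecture.HodgeConjecture`), as in every `Cruxes/…/Lines/*.lean` of this sub-problem
set_option linter.dupNamespace false

noncomputable section

namespace Summit.HodgeConjecture.HodgeConjecture.Cruxes.H413.SpectrumInterfaces


open scoped TensorProduct Matrix
open NumberField NumberField.InfinitePlace IsDedekindDomain
open HodgeCM.Model HodgeCM.Model.LiuIndex HodgeCM.Model.TowerCarrier
open Summit.HodgeConjecture.CorCM.Model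
open Literature.AlgebraicGeometry.Motives (CMType AbelianVariety)
open Literature.AlgebraicGeometry.HodgeTheory Literature.NumberTheory.Automorphic.PicardCM
open Literature.AlgebraicGeometry.ShimuraVarieties Literature.AlgebraicGeometry.ShimuraVarieties.UnitaryCanonicalModel
open Literature.NumberTheory.ComplexMultiplication
open Literature.NumberTheory.Automorphic
open Literature.NumberTheory.Automorphic.Liu2021 Literature.NumberTheory.Automorphic.Liu2021.AppendixC
open Literature.NumberTheory.Automorphic.Liu2021.Def411WeilCarriers (lineOf locF Rep)
open Summit.HodgeConjecture.CorCM.Transposition.OmegaTransport (realUnit)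
open HodgeCM.Model.ArchSideTerm (e₁)
open Literature.NumberTheory.GelbartRogawski1991 Literature.NumberTheory.GelbartRogawski1991.UnitaryDualPair
open Literature.RepresentationTheory Literature.RepresentationTheory.Liu2021
open Summit.HodgeConjecture.CorCM
open Summit.HodgeConjecture.CorCM.Transposition
open Literature.NumberTheory.GelbartRogawski1991.OscillatorTripleDictionary (OccursInH1 IsIsoToOmega rhoTriple)
open Summit.HodgeConjecture.CorCM.Lines.A3Liu418 (Thm415AtFace EpsRigidAtFace)
open Summit.HodgeConjecture.HodgeConjecture.Theses (HCCMUnconditional.HDel)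
open MulAction
open Literature.Geometry.ComplexHyperbolic.BallModel (U21 x₀)
open Summit.HodgeConjecture.CorCM.Lines.A3Liu413 (datum413)
open Summit.HodgeConjecture.HodgeConjecture.Cruxes.H413.CohFormsCarriers

/-! ## §0  The three binder types of the floor, VERBATIM (floor V7 ll. 72–85) — pasted token-identically from the line of record v3 §0 (A-p18 (g15)) -/

set_option synthInstance.maxHeartbeats 400000 in
set_option maxHeartbeats 8000000 in
/-- **TARGET TYPE `HdictEType`** = the TYPE of the `hdictE` binder of ★ p756419 `hc_cm_of_generic_floor_v7` (`Theorems/HCCMUnconditionalOfGenericFloorV7.lean` ll. 72–75)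
BYTE-FOR-BYTE = the statement of the registered stub `stub_oscillatorTriple_dictionaryExistence` (`Cruxes/H413/Lines/a3_liu413.lean` v10.2 :271–276): row III-2 (a)′, the
∀-face closure of `GelbartRogawski1991.oscillatorTriple_dictionaryExistence` at the printed datum. [cite: Liu2021, proof of Prop. 4.13, l. 2145 (first sentence); Rem. 4.14]
[cite: GelbartRogawski1991, Introduction p. 448 L30–33; Thm 5.1.1 p. 465] -/
def HdictEType : Prop :=
      ∀ (hDel : Literature.AlgebraicGeometry.ShimuraVarieties.UnitaryCanonicalModel.canonicalModel_exists_printed)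
        (F : HodgeCM.CMField) [IsGalois ℚ F] (h6 : 6 ≤ Module.finrank ℚ F) {ι₁ : F →+* ℂ} (V : HodgeCM.HermSpace3 F ι₁) (a₀ : RealScalar F)
        (Φ : CMType F) (hΦ : ι₁ ∈ Φ.1) (i : (I V (repAt a₀) (muLiu ι₁ GramClass.rep))),
        oscillatorTriple_dictionaryExistence (((uniformOmegaRep (Summit.HodgeConjecture.CorCM.DelRec.exists_recordSystem_of_printed hDel) ⟨HodgeCM.CMField.K F⟩ ι₁ ⟨HodgeCM.HermSpace3.Hm V, HodgeCM.HermSpace3.isHermitian V, HodgeCM.HermSpace3.signature_ι₁ V, HodgeCM.HermSpace3.posDef_of_ne V⟩ Φ e₁ (frameD V) (frameD_real V) (frameD_ne V) (ιVE V) (2 * imagUnit (HodgeCM.CMField.K F))⁻¹ (fun _ _ => (Rep.update ↥(maximalRealSubfield (HodgeCM.CMField.K F)) (imagUnitSq (HodgeCM.CMField.K F)) (Rep.ofLineOf ↥(maximalRealSubfield (HodgeCM.CMField.K F)) (imagUnitSq (HodgeCM.CMField.K F))) (locF ↥(maximalRealSubfield (HodgeCM.CMField.K F)) (imagUnitSq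 (HodgeCM.CMField.K F)) (realUnit ⟨HodgeCM.CMField.K F⟩ (repAt a₀ (Sigma.fst i)).1 (repAt a₀ (Sigma.fst i)).2.1 (repAt a₀ (Sigma.fst i)).2.2)) (realUnit ⟨HodgeCM.CMField.K F⟩ (repAt a₀ (Sigma.fst i)).1 (repAt a₀ (Sigma.fst i)).2.1 (repAt a₀ (Sigma.fst i)).2.2) rfl)))).prop413Data ((liuDictionaryPin exists_isReal_hodgeModel_holds hodgePQ_independent_of_hodgeModel_holds BallQuotient.ballQuotientUniformised_holds (cmAbelianVarietyRealised_of_eigenbasis exists_isReal_hodgeModel_holds hodgePQ_independent_of_hodgeModel_holds cmAbelianVarietyEigenbasisRealised_holds) Literature.NumberTheory.Transcendental.arapura2012_cor_15_4_6_holds V (I V (repAt a₀) (muLiu ι₁ GramClass.rep)) (line V (repAt a₀) (muLiu ι₁ GramClass.rep)))).H)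

set_option synthInstance.maxHeartbeats 400000 in
set_option maxHeartbeats 8000000 in
/-- The `hJ3a` binder type of floor V7 (ll. 77–80) BYTE-FOR-BYTE — programme P3's target (row III-J3a), a HYPOTHESIS of head 3 only. [cite: Rogawski1990, Thm. 13.3.1]
[cite: Liu2021, proof of Prop. 4.13, ll. 2131–2145] -/
def HJ3aType : Prop :=
      ∀ (hDel : Literature.AlgebraicGeometry.ShimuraVarieties.UnitaryCanonicalModel.canonicalModel_exists_printed)
        (F : HodgeCM.CMField) [IsGalois ℚ F] (h6 : 6 ≤ Module.finrank ℚ F) {ι₁ : F →+* ℂ} (V : HodgeCM.HermSpace3 F ι₁) (a₀ : RealScalar F)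
        (Φ : CMType F) (hΦ : ι₁ ∈ Φ.1) (i : (I V (repAt a₀) (muLiu ι₁ GramClass.rep))),
        (((uniformOmegaRep (Summit.HodgeConjecture.CorCM.DelRec.exists_recordSystem_of_printed hDel) ⟨HodgeCM.CMField.K F⟩ ι₁ ⟨HodgeCM.HermSpace3.Hm V, HodgeCM.HermSpace3.isHermitian V, HodgeCM.HermSpace3.signature_ι₁ V, HodgeCM.HermSpace3.posDef_of_ne V⟩ Φ e₁ (frameD V) (frameD_real V) (frameD_ne V) (ιVE V) (2 * imagUnit (HodgeCM.CMField.K F))⁻¹ (fun _ _ => (Rep.update ↥(maximalRealSubfield (HodgeCM.CMField.K F)) (imagUnitSq (HodgeCM.CMField.K F)) (Rep.ofLineOf ↥(maximalRealSubfield (HodgeCM.CMField.K F)) (imagUnitSq (HodgeCM.CMField.K F))) (locF ↥(maximalRealSubfield (HodgeCM.CMField.K F)) (imagUnitSq (HodgeCM.CMField.K F)) (realUnit ⟨HodgeCM.CMField.K F⟩ (repAt a₀ (Sigma.fst i)).1 (repAt a₀ (Sigma.fst i)).2.1 (repAt a₀ (Sigma.fst i)).2.2)) (realUnit ⟨HodgeCM.CMField.K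 F⟩ (repAt a₀ (Sigma.fst i)).1 (repAt a₀ (Sigma.fst i)).2.1 (repAt a₀ (Sigma.fst i)).2.2) rfl)))).prop413Data ((liuDictionaryPin exists_isReal_hodgeModel_holds hodgePQ_independent_of_hodgeModel_holds BallQuotient.ballQuotientUniformised_holds (cmAbelianVarietyRealised_of_eigenbasis exists_isReal_hodgeModel_holds hodgePQ_independent_of_hodgeModel_holds cmAbelianVarietyEigenbasisRealised_holds) Literature.NumberTheory.Transcendental.arapura2012_cor_15_4_6_holds V (I V (repAt a₀) (muLiu ι₁ GramClass.rep)) (line V (repAt a₀) (muLiu ι₁ GramClass.rep)))).H).multiplicity_le_one_printed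

set_option synthInstance.maxHeartbeats 400000 in
set_option maxHeartbeats 8000000 in
/-- The `hocc` binder type of floor V7 (ll. 82–85) BYTE-FOR-BYTE — programme P4's target (row III-2 (c)′), a HYPOTHESIS of head 3 only.
[cite: Liu2021, proof of Prop. 4.13, l. 2145 («Conversely …»)] [cite: GelbartRogawski1991, Thm 5.1.1 p. 465] [cite: Li1992, Thm. 2.1] -/
def HoccType : Prop :=
      ∀ (hDel : Literature.AlgebraicGeometry.ShimuraVarieties.UnitaryCanonicalModel.canonicalModel_exists_printed)
        (F : HodgeCM.CMField) [IsGalois ℚ F] (h6 : 6 ≤ Module.finrank ℚ F) {ι₁ : F →+* ℂ} (V : HodgeCM.HermSpace3 F ι₁) (a₀ : RealScalar F)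
        (Φ : CMType F) (hΦ : ι₁ ∈ Φ.1) (i : (I V (repAt a₀) (muLiu ι₁ GramClass.rep))),
        admissible_occursInH1 (((uniformOmegaRep (Summit.HodgeConjecture.CorCM.DelRec.exists_recordSystem_of_printed hDel) ⟨HodgeCM.CMField.K F⟩ ι₁ ⟨HodgeCM.HermSpace3.Hm V, HodgeCM.HermSpace3.isHermitian V, HodgeCM.HermSpace3.signature_ι₁ V, HodgeCM.HermSpace3.posDef_of_ne V⟩ Φ e₁ (frameD V) (frameD_real V) (frameD_ne V) (ιVE V) (2 * imagUnit (HodgeCM.CMField.K F))⁻¹ (fun _ _ => (Rep.update ↥(maximalRealSubfield (HodgeCM.CMField.K F)) (imagUnitSq (HodgeCM.CMField.K F)) (Rep.ofLineOf ↥(maximalRealSubfield (HodgeCM.CMField.K F)) (imagUnitSq (HodgeCM.CMField.K F))) (locF ↥(maximalRealSubfield (HodgeCM.CMField.K F)) (imagUnitSq (HodgeCM.CMField.K F)) (realUnit ⟨HodgeCM.CMField.K F⟩ (repAt a₀ (Sigma.fst i)).1 (repAt a₀ (Sigma.fst i)).2.1 (repAt a₀ (Sigma.fst i)).2.2)) (realUnit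 ⟨HodgeCM.CMField.K F⟩ (repAt a₀ (Sigma.fst i)).1 (repAt a₀ (Sigma.fst i)).2.1 (repAt a₀ (Sigma.fst i)).2.2) rfl)))).prop413Data ((liuDictionaryPin exists_isReal_hodgeModel_holds hodgePQ_independent_of_hodgeModel_holds BallQuotient.ballQuotientUniformised_holds (cmAbelianVarietyRealised_of_eigenbasis exists_isReal_hodgeModel_holds hodgePQ_independent_of_hodgeModel_holds cmAbelianVarietyEigenbasisRealised_holds) Literature.NumberTheory.Transcendental.arapura2012_cor_15_4_6_holds V (I V (repAt a₀) (muLiu ι₁ GramClass.rep)) (line V (repAt a₀) (muLiu ι₁ GramClass.rep)))).H)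

/-! ## §1  The middle object = programme P4's carriers ★ p787557 `Theorems/H413CohFormsCarriers.lean` (A-p13 (g21); namespace `…Cruxes.H413.CohFormsCarriers`, opened above):
`adelicDatum F V` (= `UnitaryGroup.adelicGroupData (K F) 3 (Hm V) …`), `finToAdelic`, `ArchFactor` (+ `IsHonest`), `rightRep F V`, `smoothFun`, `conjFun`, `holCotForms`, `cohForms`,
THE FACTOR OF RECORD `archFactorOf F V` — shared with programmes P4 and P2 BY NAME. -/

/-! ## §2  Generic shapes over a [Liu2021, Prop. 4.13] datum `P` — PASTED TOKEN-IDENTICALLY from the line of record v3 §2 (A-p18 (g15)); new in this file: `OccursInSomePart`,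
`spectrumIsThetaAtLevel_of_parts` (end of the section) -/

section Generic

variable {F₀ E₀ : Type} [Field F₀] [NumberField F₀] [IsTotallyReal F₀] [Field E₀] [NumberField E₀] [Algebra F₀ E₀]
  [IsTotallyComplex E₀] [Algebra.IsQuadraticExtension F₀ E₀]

/-- **«`ε` is GLOBAL»** — the collection `ε = (ε_v)_v` is the class of ONE non-zero trace-zero element `e ∈ E^{×−}`: `ε_v = e · Nm_{E_v/F_v} E_v^×` for every finite `v`
([Liu2021, Def. 4.12], first bullet; such `ε` satisfy Def. 4.11's proviso «`ε_v ∈ O^× · Nm` for all but finitely many `v`», so `(μ, ε, χ)` is a GENUINE adèlic oscillator triple —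
never the junk line of the carrier `P.Eps`).  `μ`-admissibility = this AND the sign condition at `Φ_μ` (`isGlobalEps_of_isAdmissible`).
[cite: Liu2021, Def. 4.11 (l. 2088) and Def. 4.12 (l. 2102–2108)] -/
def IsGlobalEps (P : Prop413Data F₀ E₀) (ε : P.Eps) : Prop :=
  letI : IsCMField E₀ := isCMField F₀ E₀
  ∃ e : E₀, e ≠ 0 ∧ IsCMField.complexConj E₀ e = -e ∧ P.epsOf e = ε

/-- **«`σ` and `σ'` are HECKE-RELATED at level `K`»** — a `ℂ`-linear map `σ → σ'` carrying the `K`-fixed vectors `σ^K` into `σ'^K`, commuting there with every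
Hecke operator `[KgK]` (the tree's `heckeOperator _ K g`), and NON-ZERO on `σ^K`: exactly the hypothesis shape of ★ `HeckeFixedVectorsLift.nonempty_equiv_of_heckeEquivariant`
([BushnellHenniart2006, §4.3 Proposition]: between IRREDUCIBLES such a map is the restriction of an isomorphism).  This is the finite-level currency a trace-formula ∕ `ℋ_K`-module
comparison delivers ([BergeronMillsonMoeglin2016Balls, Part 2 §1.8]). [cite: BushnellHenniart2006, §4.2–4.3] [cite: Bump1997, Prop. 4.2.3] -/
def HeckeRelatedAt {G : Type} [Group G] (K : Subgroup G) {W W' : Type} [AddCommGroup W] [Module ℂ W] [AddCommGroup W'] [Module ℂ W']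
    (σ : Representation ℂ G W) (σ' : Representation ℂ G W') : Prop :=
  ∃ φ : W →ₗ[ℂ] W', (∀ v ∈ σ.fixedPoints K, φ v ∈ σ'.fixedPoints K) ∧
    (∀ g : G, ∀ v ∈ σ.fixedPoints K, φ (heckeOperator σ K g v) = heckeOperator σ' K g (φ v)) ∧
    ∃ v ∈ σ.fixedPoints K, φ v ≠ 0

/-- **«`σ` OCCURS in the function space `A ≤ X`»** (for a `P.G`-module of functions `R` on `X`, e.g. `X = (U(V)(𝔸_{F⁺}) → ℂ²)` with right translation and `A = cohForms 𝔞`):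
a NON-ZERO `P.G`-equivariant `ℂ`-linear map `W → X` with values in `A` — the function-space analogue of `OccursInH1` ([Liu2021, proof of Prop. 4.13, l. 2131] «contributes»).
[cite: Liu2021, proof of Prop. 4.13, l. 2131] [cite: BorelJacquet1979, §4.6] -/
def OccursIn (P : Prop413Data F₀ E₀) {X : Type} [AddCommGroup X] [Module ℂ X] (R : Representation ℂ P.G X) (A : Submodule ℂ X)
    {W : Type} [AddCommGroup W] [Module ℂ W] (σ : Representation ℂ P.G W) : Prop :=
  ∃ θ : W →ₗ[ℂ] X, θ ≠ 0 ∧ (∀ w, θ w ∈ A) ∧ ∀ (g : P.G) (w : W), θ (σ g w) = R g (θ w)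

/-- **Shape of stub U1 — REALISATION of `H¹_{B,τ'}(A_∞, ℂ)` in the function space** (Matsushima–Hodge, the inverse of a class map): an INJECTIVE `P.G`-equivariant `ℂ`-linear
map `r : H¹_{B,τ'} → X` with values in `A`.  With P4's injective equivariant class map `A → H¹_{B,τ'}` this says `A ≅ H¹_{B,τ'}` ([BorelWallach2000, VII 3.2 ∕ 3.6] with Hodge
theory). [cite: BorelWallach2000, VII 2.10, 3.2, 3.6; XIII 1.2] [cite: VoisinHodgeI2002, Prop. 6.11 and Cor. 7.6] -/
def RealisedIn (P : Prop413Data F₀ E₀) (τ' : E₀ →+* ℂ) {X : Type} [AddCommGroup X] [Module ℂ X] (R : Representation ℂ P.G X)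
    (A : Submodule ℂ X) : Prop :=
  ∃ r : P.HB τ' →ₗ[ℂ] X, Function.Injective r ∧ (∀ x, r x ∈ A) ∧ ∀ (g : P.G) (x : P.HB τ'), r (P.rhoB τ' g x) = R g (r x)

/-- **Shape of stub U2 — «the spectrum of `A` is theta, at finite level» (THE LONG POLE).**  For `P.n = 3`: every IRREDUCIBLE `P.G`-representation `σ` occurring in `A`
(`OccursIn`) admits a compact open `K ≤ P.G` and a GENUINE adèlic oscillator triple `t = (μ, ε, χ)` — `μ` of weight one, `ε` global — with `σ` and `ω_t` HECKE-RELATED at level `K`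
(`HeckeRelatedAt`: a Hecke-equivariant linear map `σ → ω_t`, non-zero on `σ^K`).  At `A = cohForms 𝔞`: [GR91, Introduction p. 448 L30–33] «every discrete `π` with `H¹(Lie(U), K, π_∞)
≠ 0` is a Weil representation» for the anisotropic `U(V)`, on the finite part at level `K` ([Rogawski1990, Thm. 13.3.6 (c), §14.4, §15.3, Prop. 15.2.1 (b)]; [GR91, Lem. 5.1.2,
Thm. 5.1.1]; [Liu2021, App. D Lem. D.1, Lem. D.2 (2)]; [BMM16 (Balls), Part 2 §1.8] for the `ℋ_K`-module form).  Stated over REAL carriers only; no automorphic object is posited.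
[cite: GelbartRogawski1991, Introduction p. 448 L30–33; Thm 5.1.1 p. 465; Lemma 5.1.2 p. 466] [cite: Rogawski1990, Thm. 13.3.6; §14.4; §15.3; Prop. 15.2.1]
[cite: Liu2021, proof of Prop. 4.13 l. 2131, l. 2145; Rem. 4.14; App. D Lem. D.1 l. 5241, 5255; Lem. D.2 (2)] [cite: BergeronMillsonMoeglin2016Balls, Part 2 §1.8] -/
def SpectrumIsThetaAtLevel (P : Prop413Data F₀ E₀) {X : Type} [AddCommGroup X] [Module ℂ X] (R : Representation ℂ P.G X)
    (A : Submodule ℂ X) : Prop :=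
  P.n = 3 → ∀ (W : Type) [AddCommGroup W] [Module ℂ W] (σ : Representation ℂ P.G W),
    σ.IsIrreducible → OccursIn P R A σ →
      ∃ K : Subgroup P.G, IsOpen (K : Set P.G) ∧ IsCompact (K : Set P.G) ∧
        ∃ t : P.Triple, t.HasWeightOne ∧ IsGlobalEps P t.ε ∧ HeckeRelatedAt K σ (rhoTriple P t)

/-- **[Liu2021, Def. 4.11]'s adjective «irreducible» (the tree's READING I1 `IsIrreducibleOrZero`, ★ `Def411AsPrinted`) of the datum's `ω_t` for every weight-one triple** —
at the pin this is the route item `H411` (★ `Theorems.H411_proof`), see `omegaIrreducibleOrZero_datum413`. [cite: Liu2021, Def. 4.11 (l. 2092–2096)] -/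
def OmegaIrreducibleOrZero (P : Prop413Data F₀ E₀) : Prop :=
  ∀ t : P.Triple, t.HasWeightOne → IsIrreducibleOrZero (rhoTriple P t)

/-- **Hecke-level rigidity against the genuine `ω_t`** (formerly stub U3 of v1; a THEOREM in v2, `heckeLevelRigidity_of_omegaIrreducibleOrZero`): for every IRREDUCIBLE `σ`, every
adèlic oscillator triple `t` with `μ` of weight one and `ε` global, and every compact open `K`: if `σ` and `ω_t` are Hecke-related at level `K` then `σ ≅ ω_t` equivariantly
(`IsIsoToOmega`).  Printed content: [BushnellHenniart2006, §4.3 Proposition] (irreducibles are detected on their simple `ℋ(G,K)`-modules of `K`-fixed vectors; ★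
`HeckeFixedVectorsLift`) + Def. 4.11's adjective of `ω_t`. [cite: BushnellHenniart2006, §4.3] [cite: Bump1997, Prop. 4.2.3] [cite: Liu2021, Def. 4.11 (l. 2092–2096)] -/
def HeckeLevelRigidity (P : Prop413Data F₀ E₀) : Prop :=
  ∀ (W : Type) [AddCommGroup W] [Module ℂ W] (σ : Representation ℂ P.G W), σ.IsIrreducible →
    ∀ t : P.Triple, t.HasWeightOne → IsGlobalEps P t.ε →
      ∀ K : Subgroup P.G, IsOpen (K : Set P.G) → IsCompact (K : Set P.G) →
        HeckeRelatedAt K σ (rhoTriple P t) → IsIsoToOmega P σ t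

/-- **Shape of stub U4 — the sign rule «occurring ⟹ admissible» for GENUINE triples.**  For `P.n = 3`, every `τ'`, every adèlic oscillator triple `t = (μ, ε, χ)` with `μ`
of weight one and `ε` GLOBAL: if `ω_t` occurs in `H¹_{B,τ'}(A_∞, ℂ)` then `ε` is `μ`-admissible (Def. 4.12: the archimedean signs of the global `e` at `Φ_μ`).  Printed content:
[GR91, Introduction p. 446 L9–11] = [Rogawski1992, Thm. 1.1] ∕ [Rogawski1990, Thm. 13.3.7] «an element `π = ⊗π_v` of `Π(ρ)` is discrete iff `(−1)^{|X|} = ε(½, φ)`» with [GR91,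
Thm. 5.1.1], read in Liu's labels ([Liu2021, Rem. 4.14]; archimedean matching by [Liu2021, Lem. D.2 (2)]); alternatively the theta dichotomy [HarrisKudlaSweet1996] with the Rallis
inner product formula [Li1992, Thm. 2.1].  = the (⇒) half of `muAdmissible_iff_multiplicity_one` RESTRICTED to global `ε` (REF1 2026-08-28T12:49:36Z: the unrestricted half is
false on the junk line; this restriction is exactly print's domain). [cite: GelbartRogawski1991, Introduction p. 446 L9–11; Thm 5.1.1 p. 465] [cite: Rogawski1992, Thm. 1.1]
[cite: Rogawski1990, Thm. 13.3.7] [cite: Liu2021, proof of Prop. 4.13 l. 2145; Def. 4.12; Lem. D.2 (2)] [cite: HarrisKudlaSweet1996] [cite: Li1992, Thm. 2.1] -/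
def OccurringGlobalThetaIsAdmissible (P : Prop413Data F₀ E₀) : Prop :=
  P.n = 3 → ∀ (τ' : E₀ →+* ℂ) (t : P.Triple), t.HasWeightOne → IsGlobalEps P t.ε →
    OccursInH1 P τ' (rhoTriple P t) → t.IsAdmissible

/-- **U2a SHAPE — «every irreducible occurring in `A` occurs in SOME part»**: at `n = 3`, every irreducible `σ` with a non-zero equivariant map into `A` has a non-zero equivariant
map into `part i` for some index `i` (at the pin: `i` = a discrete automorphic representation `Π ≤ L²(U(V)(F⁺)\U(V)(𝔸_{F⁺}))`, `part i` = the cotangent part of `Π`). Spectral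
decomposition of the compact quotient + isotypic projection. [cite: BorelJacquet1979, §4.6] [cite: GelfandGraevPiatetskiShapiro1969, Ch. 1 §2.3] [cite: BorelWallach2000, XIII 1.2] -/
def OccursInSomePart (P : Prop413Data F₀ E₀) {X : Type} [AddCommGroup X] [Module ℂ X] (R : Representation ℂ P.G X) (A : Submodule ℂ X)
    {ι : Type} (part : ι → Submodule ℂ X) : Prop :=
  P.n = 3 →
    ∀ (W : Type) [AddCommGroup W] [Module ℂ W] (σ : Representation ℂ P.G W), σ.IsIrreducible → OccursIn P R A σ → ∃ i : ι, OccursIn P R (part i) σ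

end Generic

/-! ## §2b  The `L²` junction at the carriers (NEW): realisations of cotangent forms in `L²(U(V)(F⁺)\U(V)(𝔸_{F⁺}), μ)` and the cotangent ∕ holomorphic ∕ antiholomorphic PART of a
discrete automorphic representation `Π` (★ `AutomorphicSpectrum.lean`: `AdelicGroupData.L2`, `rightRegular`, `DiscreteAutomorphicRep`; ★ `AdelicGroupData.IsAutomorphicMeasure`) -/

section L2Junction

variable (F : HodgeCM.CMField) {ι₁ : F →+* ℂ} (V : HodgeCM.HermSpace3 F ι₁)

/-- The quotient map `U(V)(𝔸_{F⁺}) → U(V)(F⁺)\U(V)(𝔸_{F⁺})` (`= 𝒢.Adelic ⧸ 𝒢.quotientSubgroup`, `quotientSubgroup = ⊥ ⊔ G(K) = G(K)` since `center' = ⊥` for the unitary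
datum) in the `automorphicQuotient` spelling. [cite: BorelJacquet1979, §4.1] -/
def quotMk : (adelicDatum F V).Adelic → (adelicDatum F V).automorphicQuotient :=
  fun h => (h : (adelicDatum F V).Adelic ⧸ (adelicDatum F V).quotientSubgroup)

/-- **`Represents 𝔞 μ ℓ`** — the linear map `ℓ : X →ₗ[ℂ] (Fin 2 → L²(μ))` REALISES the cotangent forms of the factor `𝔞` in `L²`: for every `f ∈ cohForms 𝔞` and each coordinate
`k`, the class `ℓ f k` has a CONTINUOUS representative `φ` on the (compact) quotient which descends `h ↦ f h⁻¹ k` (left-`U(V)(F⁺)`-invariance of weight forms makes `h ↦ f h⁻¹ k`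
right-invariant, so it descends along `h ↦ h · U(V)(F⁺)`; the inversion matches right translation `rightRep` with `rightRegular`, `(R g φ)(x) = φ(g⁻¹ • x)`).  Values of `ℓ` off
`cohForms 𝔞` are unconstrained (never used). [cite: BorelJacquet1979, §4.2, §4.6] [cite: Borel1963, §5] -/
def Represents (𝔞 : ArchFactor F V) (μ : MeasureTheory.Measure (adelicDatum F V).automorphicQuotient) [(adelicDatum F V).IsAutomorphicMeasure μ]
    (ℓ : ((adelicDatum F V).Adelic → (Fin 2 → ℂ)) →ₗ[ℂ] (Fin 2 → (adelicDatum F V).L2 μ)) : Prop :=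
  ∀ f ∈ cohForms 𝔞, ∀ k : Fin 2, ∃ φ : ContinuousMap (adelicDatum F V).automorphicQuotient ℂ,
    (∀ h : (adelicDatum F V).Adelic, φ (quotMk F V h) = f h⁻¹ k) ∧
      ((ℓ f k : (adelicDatum F V).L2 μ) : (adelicDatum F V).automorphicQuotient → ℂ) =ᵐ[μ] ⇑φ

/-- **`cotPart 𝔞 μ ℓ Π`** — the COTANGENT PART of the discrete automorphic representation `Π` (for the factor `𝔞`, through the realisation `ℓ`): the forms `f ∈ cohForms 𝔞` all of
whose `L²`-coordinates `ℓ f k` lie in the closed irreducible invariant subspace `Π.space ≤ L²(μ)`.  `cotPart ≠ ⊥` says «`Π` is `H¹`-cohomological at `𝔞` (type `(1,0)` or `(0,1)`)».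
[cite: BorelWallach2000, VII 3.2; XIII 1.2] [cite: Rogawski1990, §12.3; Thm. 13.3.6] -/
def cotPart (𝔞 : ArchFactor F V) (μ : MeasureTheory.Measure (adelicDatum F V).automorphicQuotient) [(adelicDatum F V).IsAutomorphicMeasure μ]
    (ℓ : ((adelicDatum F V).Adelic → (Fin 2 → ℂ)) →ₗ[ℂ] (Fin 2 → (adelicDatum F V).L2 μ)) (π : DiscreteAutomorphicRep (adelicDatum F V) μ) :
    Submodule ℂ ((adelicDatum F V).Adelic → (Fin 2 → ℂ)) :=
  cohForms 𝔞 ⊓ ⨅ k : Fin 2, (π.space.toSubmodule).comap ((LinearMap.proj k).comp ℓ)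

/-- **`holPart 𝔞 μ ℓ Π`** — the HOLOMORPHIC (`(1,0)`) cotangent part of `Π`: as `cotPart` with `holCotForms 𝔞` in place of `cohForms 𝔞`.  «`Π` is `(1,0)`-cohomological at `𝔞`» :=
`holPart ≠ ⊥` (programme P3's letters E1′∕E2′, F0P3-plan (g0) D2). [cite: Rogawski1990, §12.3] [cite: BorelWallach2000, VI] -/
def holPart (𝔞 : ArchFactor F V) (μ : MeasureTheory.Measure (adelicDatum F V).automorphicQuotient) [(adelicDatum F V).IsAutomorphicMeasure μ]
    (ℓ : ((adelicDatum F V).Adelic → (Fin 2 → ℂ)) →ₗ[ℂ] (Fin 2 → (adelicDatum F V).L2 μ)) (π : DiscreteAutomorphicRep (adelicDatum F V) μ) :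
    Submodule ℂ ((adelicDatum F V).Adelic → (Fin 2 → ℂ)) :=
  holCotForms 𝔞 ⊓ ⨅ k : Fin 2, (π.space.toSubmodule).comap ((LinearMap.proj k).comp ℓ)

/-- **`antiholPart 𝔞 μ ℓ Π`** — the ANTIHOLOMORPHIC (`(0,1)`) cotangent part of `Π`: as `cotPart` with the `conjFun`-image of `holCotForms 𝔞`. [cite: Rogawski1990, §12.3]
[cite: VoisinHodgeI2002, Cor. 7.6] -/
def antiholPart (𝔞 : ArchFactor F V) (μ : MeasureTheory.Measure (adelicDatum F V).automorphicQuotient) [(adelicDatum F V).IsAutomorphicMeasure μ]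
    (ℓ : ((adelicDatum F V).Adelic → (Fin 2 → ℂ)) →ₗ[ℂ] (Fin 2 → (adelicDatum F V).L2 μ)) (π : DiscreteAutomorphicRep (adelicDatum F V) μ) :
    Submodule ℂ ((adelicDatum F V).Adelic → (Fin 2 → ℂ)) :=
  (holCotForms 𝔞).map (conjFun F V) ⊓ ⨅ k : Fin 2, (π.space.toSubmodule).comap ((LinearMap.proj k).comp ℓ)

end L2Junction

/-! ## §3  Stub TYPES at the printed datum of every face (`P = datum413 hDel F V a₀ Φ i`, `R = rightRep F V`, `A = cohForms (archFactorOf F V)`).  U1′, the PARENT type U2′, the closed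
Def. 4.11 link and U4 are PASTED TOKEN-IDENTICALLY from the line of record v3 §3 (A-p18 (g15)); U2ℓ, U2a, E2E2b (§3b) are new. -/

set_option synthInstance.maxHeartbeats 400000 in
set_option maxHeartbeats 8000000 in
/-- STUB TYPE **U1′ — MATSUSHIMA–HODGE REALISATION AT THE PIN, AT THE FACTOR OF RECORD** (M–L; the inverse direction of P4's T2′): for every face, at `n = 3`, and every `τ'`:
`RealisedIn (datum413 …) τ' (rightRep F V) (cohForms (archFactorOf F V))` — an INJECTIVE `U(V)(𝔸_{F⁺,f})`-equivariant `ℂ`-linear map from the pin's `H¹_{B,τ'}(A_∞, ℂ)` into the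
`ℂ²`-valued functions on `U(V)(𝔸_{F⁺})`, valued in the `(1,0) ⊕ (0,1)` cotangent automorphic forms for THE archimedean factor `𝔞₀(V) = archFactorOf F V` (CM archimedean section through
`V.sylvesterFrame`; its honesty is P4's ★-to-be `Theorems/P4StubT1ArchFactor.lean` and is NOT consumed by this line's composition — A-plan1 (g17) 19:41:49Z GO (a)).  Content: at each level
`Γ`, every class in `H¹(P_Γ(V); ℂ)` of the compact Kähler surface `P_Γ = Γ\𝔹²` has a UNIQUE harmonic representative, which is a holomorphic `1`-form plus the conjugate of one ([VoisinHodgeI2002,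
§6.1.3 Prop. 6.11, Cor. 7.6, §7.2.2]: `H¹ = H^{1,0} ⊕ H^{0,1}`, `H^{1,0} = H⁰(Ω¹)`); a holomorphic `1`-form of level `Γ.K` IS a holomorphic cotangent-weight automorphic form ([Borel1997, §5.14];
[BorelWallach2000, VII 2.10, 3.6]; the levelwise dictionary with INJECTIVE `pull` is ★ `HodgeCM.Model.classMapDatumOf` ∕ `classMapDatumOf_pull_injective`, `H10 = F¹H¹(X_Γ)`); uniqueness makes
the representatives compatible with pull-back and Hecke translation (Matsushima–Murakami ∕ [BorelWallach2000, XIII 1.2]), so they assemble to an injective equivariant map out of `H = colim_K H¹`,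
read in the `adelicGroupData` currency through the transport lemmas `toLatticeModelG_archFactorOf_ιinf` ∕ `toLatticeModelG_finToAdelic` of the carriers.  Why it might fail: as P4-T2′
(the pin's `H` is the tower of the identity components; the realisation lands in forms supported accordingly — reshaping, not failure).  SIZE M–L; desk shared with P4-T2′ (together:
`cohForms 𝔞₀(V) ≅ H¹_{B,τ'}`). [cite: BorelWallach2000, VII 2.10, 3.2, 3.6; XIII 1.2] [cite: VoisinHodgeI2002, Prop. 6.11, Cor. 7.6] [cite: Borel1997, §5.14] [cite: MatsushimaMurakami1963, §4] -/
def StubU1RealisationAt : Prop :=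
      ∀ (hDel : Literature.AlgebraicGeometry.ShimuraVarieties.UnitaryCanonicalModel.canonicalModel_exists_printed)
        (F : HodgeCM.CMField) [IsGalois ℚ F] (h6 : 6 ≤ Module.finrank ℚ F) {ι₁ : F →+* ℂ} (V : HodgeCM.HermSpace3 F ι₁) (a₀ : RealScalar F)
        (Φ : CMType F) (hΦ : ι₁ ∈ Φ.1) (i : (I V (repAt a₀) (muLiu ι₁ GramClass.rep))),
      (datum413 hDel F V a₀ Φ i).n = 3 →
        ∀ τ' : HodgeCM.CMField.K F →+* ℂ, RealisedIn (datum413 hDel F V a₀ Φ i) τ' (rightRep F V) (cohForms (archFactorOf F V))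

set_option synthInstance.maxHeartbeats 400000 in
set_option maxHeartbeats 8000000 in
/-- STUB TYPE **U2′ — THE `(1,0) ⊕ (0,1)` COTANGENT AUTOMORPHIC SPECTRUM OF `U(V)` IS THETA, AT FINITE LEVEL, AT THE FACTOR OF RECORD** (XL — THE LONG POLE; shares programme P3's engine):
for every face, `SpectrumIsThetaAtLevel (datum413 …) (rightRep F V) (cohForms (archFactorOf F V))` — at `n = 3`, every irreducible `U(V)(𝔸_{F⁺,f})`-representation with a non-zero equivariant
map into `cohForms (archFactorOf F V)` has a compact open level `K` and a genuine triple `t` (`μ` weight one, `ε` global) with `σ`, `ω_V(t)` HECKE-RELATED at `K` (`HeckeRelatedAt`: a linear `σ → ω_V(t)`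
carrying `σ^K` into `ω_V(t)^K`, commuting with every `[KgK]`, non-zero on `σ^K`).
ROUTE (the only road in print for the anisotropic `U(V)`, [Liu2021, Rem. 4.14]): U2a the `U(V)(𝔸_{F⁺})`-span of a form in `cohForms 𝔞` inside `L²(U(V)(F⁺)\U(V)(𝔸_{F⁺}))` is a
finite sum of discrete automorphic representations (★ `UnitaryGroup.isDiscretelyDecomposable_rightRegular_cmDatum`: `L² = L²_disc`, compact quotient) whose finite parts contain
`σ`; U2b their archimedean components have the cotangent `K_∞`-type with (anti)holomorphic germs, i.e. are `J^±` ⊠ 𝟙 ([BorelWallach2000, VI]; [VoganZuckerman1984]; [Liu2021,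
Lem. D.2 (2)], tree `LemD2AsPrinted`); U2c `π ∈ Π(ρ)`, `dim ρ = 1` ([Rogawski1990, Thm. 13.3.6 (c), §14.6] — STABLE TRACE FORMULA for `U(3)` and its inner forms); U2d the members
of `Π(ρ_v)` are the local Weil representations ([GR91, Lem. 5.1.2]; tree `LocalAPackets.lean`; Howe duality for `U(1) × U(3)`) + Flath + the dictionary `ω(μ_v,ε_v,χ_v) =`
[GR90]'s local Weil representation ([Liu2021, App. D Lem. D.1 l. 5241∕5255]) giving the Hecke-related map at any `K` fixing a vector.  WHY PLAUSIBLY TRUE: it is [GR91, p. 448 L30–33]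
for `U(V)`, proved in print via [Rog90]; for all `n` it is [Liu2021, l. 2145, first sentence].  WHY IT MIGHT FAIL (as a statement): only through a mismatch between the tree's
`ω_V(t)` and print's `ω(μ,ε,χ)` — excluded by Lem. D.1 (rows hD1″∕h411, `Def411WeilCarriers*`).  SIZE XL (the U2c sub-desk is P3's).
[cite: GelbartRogawski1991, Introduction p. 448 L30–33; Thm 5.1.1 p. 465; Lemma 5.1.2 p. 466] [cite: Rogawski1990, Thm. 13.3.6; §14.6]
[cite: Liu2021, proof of Prop. 4.13 l. 2131, l. 2145; Rem. 4.14; App. D Lem. D.1, Lem. D.2 (2)] [cite: BorelWallach2000, VI; VII 3.2] [cite: BergeronMillsonMoeglin2016Balls, Part 2 §1.8] -/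
def StubU2CohFormsSpectrumIsThetaAt : Prop :=
      ∀ (hDel : Literature.AlgebraicGeometry.ShimuraVarieties.UnitaryCanonicalModel.canonicalModel_exists_printed)
        (F : HodgeCM.CMField) [IsGalois ℚ F] (h6 : 6 ≤ Module.finrank ℚ F) {ι₁ : F →+* ℂ} (V : HodgeCM.HermSpace3 F ι₁) (a₀ : RealScalar F)
        (Φ : CMType F) (hΦ : ι₁ ∈ Φ.1) (i : (I V (repAt a₀) (muLiu ι₁ GramClass.rep))),
      SpectrumIsThetaAtLevel (datum413 hDel F V a₀ Φ i) (rightRep F V) (cohForms (archFactorOf F V))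

set_option synthInstance.maxHeartbeats 400000 in
set_option maxHeartbeats 8000000 in
/-- STUB TYPE **U4 — THE SIGN RULE AT THE PIN** (L; theta desk shared with P4-T3): `OccurringGlobalThetaIsAdmissible (datum413 …)` — at every face, a genuine weight-one
`ω_V(μ, ε, χ)` (global `ε`) occurring in the PIN's `H¹_{B,τ'}(A_∞, ℂ)` has `ε` `μ`-admissible.  ROUTE A ([Liu2021, Rem. 4.14]): by U1 + U2a–U2c the occurring `ω_V(t)` is `π^∞`
for a discrete `π ∈ Π(ρ)` with `π_{ι₁} = J^±`; [GR91 p. 446 L9–11]∕[Rog92, Thm. 1.1]: discreteness ⟺ `(−1)^{|X|} = ε(½, φ)`, which in Liu's labels ([Liu2021, Def. 4.12]; archimedean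
sign by Lem. D.2 (2): the Hodge type `(1,0)∕(0,1)` at `τ'` fixes the sign of `Im τ'(e)` on `Φ_μ`) is `μ`-admissibility of `ε`.  ROUTE B (trace-formula-free): theta dichotomy — if
`⊗_v ω(μ_v, ε_v, χ_v)` has a non-zero automorphic realisation then the global theta lift from the `U(1)` determined by `(μ, e)` is non-zero, forcing the coherent sign collection
([HarrisKudlaSweet1996]; [Li1992, Thm. 2.1] for the non-vanishing direction).  WHY PLAUSIBLY TRUE: print.  WHY IT MIGHT FAIL: as the (⇒) half of `muAdmissible_iff_multiplicity_one`
it was REFUTED on the junk line (REF1 2026-08-28T12:49:36Z) — here `ε` is global by hypothesis, which is exactly print's domain; no other risk known.  SIZE L.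
[cite: GelbartRogawski1991, Introduction p. 446 L9–11; Thm 5.1.1 p. 465] [cite: Rogawski1992, Thm. 1.1] [cite: Liu2021, proof of Prop. 4.13 l. 2145; Def. 4.12; Lem. D.2 (2)]
[cite: HarrisKudlaSweet1996] [cite: Li1992, Thm. 2.1] -/
def StubU4SignRule : Prop :=
      ∀ (hDel : Literature.AlgebraicGeometry.ShimuraVarieties.UnitaryCanonicalModel.canonicalModel_exists_printed)
        (F : HodgeCM.CMField) [IsGalois ℚ F] (h6 : 6 ≤ Module.finrank ℚ F) {ι₁ : F →+* ℂ} (V : HodgeCM.HermSpace3 F ι₁) (a₀ : RealScalar F)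
        (Φ : CMType F) (hΦ : ι₁ ∈ Φ.1) (i : (I V (repAt a₀) (muLiu ι₁ GramClass.rep))),
      OccurringGlobalThetaIsAdmissible (datum413 hDel F V a₀ Φ i)

/-! ## §3b  The three NEW stub types of the cut (U2ℓ, U2a, E2E2b) -/

set_option synthInstance.maxHeartbeats 400000 in
set_option maxHeartbeats 8000000 in
/-- STUB TYPE **U2ℓ — COTANGENT FORMS ARE `L²`** (M): for every face there are an automorphic measure `μ` on `U(V)(F⁺)\U(V)(𝔸_{F⁺})` (★
`UnitaryGroup.exists_isAutomorphicMeasure_isDiscretelyDecomposable_adelicGroupData`, anisotropy of `Hm V` from `6 ≤ [F:ℚ]` ⇒ a definite real place) and a linear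
`ℓ : X →ₗ[ℂ] (Fin 2 → L²(μ))` realising `cohForms (archFactorOf F V)` (`Represents`).  Content: a weight form for the factor is continuous on `U(V)(𝔸_{F⁺})` (fourth conjunct of
`weightForms`) and left-`U(V)(F⁺)`-invariant, so `h ↦ f h⁻¹ k` descends to a continuous function on the COMPACT quotient, which is in `L²` of the finite measure `μ`
(`ContinuousMap.toLp`∕`BoundedContinuousFunction.mem_Lp`); `f ↦` (class of the descent) is linear on `cohForms`, extended to `X` by `LinearMap.exists_extend`.  Why it might fail: only a
typing slip in the descent (orientation `h⁻¹` is forced by `rightRegular_apply_coeFn` vs `rightRep`).  SIZE M. [cite: BorelJacquet1979, §4.2, §4.6] [cite: Borel1963, §5]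
[cite: PlatonovRapinchuk1994, Thm. 5.5] -/
def StubU2lL2Realisation : Prop :=
      ∀ (hDel : Literature.AlgebraicGeometry.ShimuraVarieties.UnitaryCanonicalModel.canonicalModel_exists_printed)
        (F : HodgeCM.CMField) [IsGalois ℚ F] (h6 : 6 ≤ Module.finrank ℚ F) {ι₁ : F →+* ℂ} (V : HodgeCM.HermSpace3 F ι₁) (a₀ : RealScalar F)
        (Φ : CMType F) (hΦ : ι₁ ∈ Φ.1) (i : (I V (repAt a₀) (muLiu ι₁ GramClass.rep))),
      ∃ (μ : MeasureTheory.Measure (adelicDatum F V).automorphicQuotient) (_ : (adelicDatum F V).IsAutomorphicMeasure μ)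
        (ℓ : ((adelicDatum F V).Adelic → (Fin 2 → ℂ)) →ₗ[ℂ] (Fin 2 → (adelicDatum F V).L2 μ)), Represents F V (archFactorOf F V) μ ℓ

set_option synthInstance.maxHeartbeats 400000 in
set_option maxHeartbeats 8000000 in
/-- STUB TYPE **U2a — SPECTRAL PROJECTION PRESERVING COTANGENT TYPE** (L): for every face, every automorphic `μ` and every realisation `ℓ` of `cohForms 𝔞₀` (`𝔞₀ = archFactorOf F V`):
at `n = 3`, every irreducible `σ` of `U(V)(𝔸_{F⁺,f})` occurring in `cohForms 𝔞₀` occurs in the cotangent part `cotPart 𝔞₀ μ ℓ Π` of SOME discrete automorphic `Π ≤ L²(μ)`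
(`OccursInSomePart … (cotPart …)`).  ROUTE: the image `θ(σ) ≤ cohForms 𝔞₀` consists of `K_c`-invariant, `K_∞`-isotypic (character `(det k₊)⁻¹ k₋` along `𝔞₀.ιinf`), `𝔷`-finite smooth vectors; `L² = L²_disc =
⊕̂ Π` (★ `isDiscretelyDecomposable_rightRegular_cmDatum` ∕ `…_adelicGroupData`; admissibility: each `K_f × K_∞`-type occurs in finitely many `Π`, [BorelJacquet1979, §4.6 (finiteness)];
[GelfandGraevPiatetskiShapiro1969, Ch. 1 §2.3]); the orthogonal projection `p_Π` onto `Π.space` commutes with `U(V)(𝔸)`, hence preserves `K_c`-invariance, the `K_∞`-type and the infinitesimal character, and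
— by [BorelWallach2000, VI; XIII 1.2] ∕ [Rogawski1990, §12.3] (the only unitary `(𝔤, K_∞)`-modules with that minimal `K_∞`-type and infinitesimal character are `J^±`, on which the type is
the (anti)holomorphic cotangent line) — maps cotangent forms to cotangent forms; some `p_Π ∘ ℓ ∘ θ ≠ 0`, and its image realises `σ` in `cotPart 𝔞₀ μ ℓ Π` (irreducibility of `σ`).
WHY IT MIGHT FAIL: the step «`p_Π` of a holomorphic cotangent form is again one» needs the archimedean classification letter (U2b, B4 desk) — a mis-typed `𝔞₀.kc`∕`K_∞`-character in the
carriers would break it (guarded by P4-T1 `archFactorOf_isHonest`).  SIZE L. [cite: BorelJacquet1979, §4.6] [cite: GelfandGraevPiatetskiShapiro1969, Ch. 1 §2.3] [cite: BorelWallach2000, VI; XIII 1.2]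
[cite: Rogawski1990, §12.3] [cite: BergeronMillsonMoeglin2016Balls, Part 2 §1.8] -/
def StubU2aSpectralProjection : Prop :=
      ∀ (hDel : Literature.AlgebraicGeometry.ShimuraVarieties.UnitaryCanonicalModel.canonicalModel_exists_printed)
        (F : HodgeCM.CMField) [IsGalois ℚ F] (h6 : 6 ≤ Module.finrank ℚ F) {ι₁ : F →+* ℂ} (V : HodgeCM.HermSpace3 F ι₁) (a₀ : RealScalar F)
        (Φ : CMType F) (hΦ : ι₁ ∈ Φ.1) (i : (I V (repAt a₀) (muLiu ι₁ GramClass.rep))),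
      ∀ (μ : MeasureTheory.Measure (adelicDatum F V).automorphicQuotient) [(adelicDatum F V).IsAutomorphicMeasure μ]
        (ℓ : ((adelicDatum F V).Adelic → (Fin 2 → ℂ)) →ₗ[ℂ] (Fin 2 → (adelicDatum F V).L2 μ)),
        Represents F V (archFactorOf F V) μ ℓ →
          OccursInSomePart (datum413 hDel F V a₀ Φ i) (rightRep F V) (cohForms (archFactorOf F V)) (cotPart F V (archFactorOf F V) μ ℓ)

set_option synthInstance.maxHeartbeats 400000 in
set_option maxHeartbeats 8000000 in
/-- STUB TYPE **E2E2b — ENGINE SOCKET: THE COTANGENT PART OF EACH DISCRETE AUTOMORPHIC `Π` HAS THETA SPECTRUM AT FINITE LEVEL** (XL; programme P3's engine ∕ F0-typ1's letters, at the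
pin): for every face, `μ`, `ℓ` realising `cohForms 𝔞₀`, and every discrete automorphic `Π ≤ L²(U(V)(F⁺)\U(V)(𝔸_{F⁺}), μ)`: `SpectrumIsThetaAtLevel (datum413 …) (rightRep F V) (cotPart 𝔞₀ μ ℓ Π)`
— at `n = 3`, every irreducible `σ` occurring in the cotangent part of `Π` is Hecke-related at some compact open level `K` to a genuine `ω_V(t)` (`μ` weight one, `ε = epsOf e` GLOBAL).
ROUTE (print): «`σ` occurs in `cotPart … Π`» ⟹ (U2b, archimedean letter) `Π_{ι₁} ≅ J^± ⊠ 𝟙_{K_c}`, `Π_f ≅ σ` (`Π` irreducible, Flath) ⟹ ([Rogawski1990, Thm. 13.3.6 (c), §14.6, §15.3 ¶1], stable trace formula for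
`U(3)` and its inner forms; `J^±` lie in the local `A`-packets `Π(ξ)` of [Rogawski1990, §12.3]) `Π ∈ Π(ρ)`, `dim ρ = 1` ⟹ ([GelbartRogawski1991, Thm. 5.1.1, Lem. 5.1.2]; Howe duality `U(1) × U(3)`)
every `Π_v` is a local Weil representation `ω(μ_v, ε_v, χ_v)` with `(μ, ε = epsOf e, χ)` global ⟹ ([Liu2021, App. D Lem. D.1], rows hD1″∕h411) `Π_f ≅ ω_V(t)`, in particular Hecke-related at
any `K` fixing a vector.  WHY IT MIGHT FAIL (as typed): only via a mismatch of the tree's `ω_V(t)` (`rhoTriple (datum413 …) t`) with print's `ω(μ,ε,χ)` — excluded by Lem. D.1 — or via the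
archimedean letter U2b (the cotangent `K_∞`-type pins `J^±`: [Rogawski1990, 12.3]; [BorelWallach2000, VI]).  STRICTLY WEAKER than the parent U2′ (`cotPart ≤ cohForms`).  SIZE XL (engine).
[cite: Rogawski1990, §12.3; Thm. 13.3.6; §14.6; §15.3] [cite: GelbartRogawski1991, Introduction p. 448 L30–33; Thm 5.1.1 p. 465; Lemma 5.1.2 p. 466] [cite: Liu2021, Rem. 4.14; App. D Lem. D.1, Lem. D.2 (2)]
[cite: Marshall2014, §3.3–3.4] -/
def StubE2E2bCotPartSpectrumIsTheta : Prop :=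
      ∀ (hDel : Literature.AlgebraicGeometry.ShimuraVarieties.UnitaryCanonicalModel.canonicalModel_exists_printed)
        (F : HodgeCM.CMField) [IsGalois ℚ F] (h6 : 6 ≤ Module.finrank ℚ F) {ι₁ : F →+* ℂ} (V : HodgeCM.HermSpace3 F ι₁) (a₀ : RealScalar F)
        (Φ : CMType F) (hΦ : ι₁ ∈ Φ.1) (i : (I V (repAt a₀) (muLiu ι₁ GramClass.rep))),
      ∀ (μ : MeasureTheory.Measure (adelicDatum F V).automorphicQuotient) [(adelicDatum F V).IsAutomorphicMeasure μ]
        (ℓ : ((adelicDatum F V).Adelic → (Fin 2 → ℂ)) →ₗ[ℂ] (Fin 2 → (adelicDatum F V).L2 μ)),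
        Represents F V (archFactorOf F V) μ ℓ →
          ∀ π : DiscreteAutomorphicRep (adelicDatum F V) μ,
            SpectrumIsThetaAtLevel (datum413 hDel F V a₀ Φ i) (rightRep F V) (cotPart F V (archFactorOf F V) μ ℓ π)

/-! ## §3d  The P4 theta-road letter type — VERBATIM from F0P4-plan (g0) `F0/P4/line-F0-P4AdmissibleOccursInH1.lean` 98373f7d760ea57a (T3a; consumed by P4 only) -/

set_option synthInstance.maxHeartbeats 400000 in
set_option maxHeartbeats 8000000 in
/-- STUB TYPE **T3a — HOLOMORPHIC THETA REALISATION OF ONE `ι₁`-CLASS** (L; the theta road proper, = v2.1 T3 for the holomorphic Hodge type):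
for every face, at `n = 3`, EITHER every weight-one admissible triple `t` with `ι₁ ∈ Φ_μ(t)`, OR every weight-one admissible triple with `ι₁ ∉ Φ_μ(t)`,
admits a NON-ZERO `U(V)(𝔸_{F⁺,f})`-EQUIVARIANT `ℂ`-linear map `θ_t : ω_V(t) → (U(V)(𝔸_{F⁺}) → ℂ²)` with values in the HOLOMORPHIC cotangent forms
`holCotForms 𝔞₀` (the disjunction is over WHICH class is the holomorphic one — [Liu2021, Lem. D.2 (2)]: `(−1,−,0) ↔ π^{1,0}`, `(1,+,0) ↔ π^{0,1}` — so that no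
sign convention of the tree's `cmType`/Weil representation is asserted).  Content («Conversely …», [Liu2021, l. 2145]): `θ_t(Φ_f) := ∫_{[U(W_t)]} Θ(φ_∞^{harm} ⊗ Φ_f)(g, h) χ(h) dh`,
the theta kernel of the pair `(U(W_t), U(V))` on the hermitian LINE of record of the class `ε` with splitting character `μ` ([Weil1964, n° 41 Thm. 6]
automorphy; [GelbartRogawski1991, §3 Prop. 3.1.1]); it is `χ`-covariant in the `U(W_t)`-variable hence FACTORS through the `χ`-coinvariants `ω_V(t)` (the pin's
`omega t` IS `TwistedCoinv.Coinv …`; ★ `weilCoinvLift`, `weilCoinvLift_eq_zero_iff`); the HARMONIC archimedean vector of `K_∞`-type `(weightOf x₀)^∨` killed by `𝔭⁻`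
exists exactly in the holomorphic class ([Liu2021, Lem. D.2 (2)] ⟸ [KonnoKonno2007, Thm. 5.4]); the Gaussian at the definite places is `K_c`-fixed ([Liu2021,
Lem. D.2 (1)]); smoothness/weight/hol-germ as in the model's ★ `ThetaDistDatum.dist_mem_weightForms` ∕ `isHolGerm_dist` ∕ `dist_ωf_V` ∕ `dist_ωf_W` (slots
`pinDatum{Zero…Three}G`); NON-VANISHING on `ω_V(t)` = Rallis inner product formula in the stable range ([Li1992, Thm. 2.1]; [Rallis1984]).  Why it might fail: as
printed it cannot (l. 2145); at the pin only through the junction of the tree's `finPairRep … (hs a_t)` with a theta-distribution datum's `ωf` (reindexing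
`FinSB`, scalar see-saw twist) — the L-sized work.  [cite: Liu2021, proof of Prop. 4.13, l. 2145; App. D Lem. D.2 (1)(2)] [cite: GelbartRogawski1991, §3 Prop. 3.1.1]
[cite: Weil1964, n° 41 Thm. 6] [cite: Li1992, Thm. 2.1] [cite: KonnoKonno2007, Thm. 5.4] -/
def StubT3aHolThetaRealisationAt : Prop :=
  ∀ (hDel : Literature.AlgebraicGeometry.ShimuraVarieties.UnitaryCanonicalModel.canonicalModel_exists_printed)
      (F : HodgeCM.CMField) [IsGalois ℚ F] (h6 : 6 ≤ Module.finrank ℚ F) {ι₁ : F →+* ℂ} (V : HodgeCM.HermSpace3 F ι₁) (a₀ : RealScalar F)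
      (Φ : CMType F) (hΦ : ι₁ ∈ Φ.1) (i : (I V (repAt a₀) (muLiu ι₁ GramClass.rep))),
      (datum413 hDel F V a₀ Φ i).n = 3 →
        (∀ (t : (datum413 hDel F V a₀ Φ i).Triple), t.HasWeightOne → t.IsAdmissible → ι₁ ∈ t.cmType.1 →
            ∃ θ : (datum413 hDel F V a₀ Φ i).omega t.μ t.isConjugateSymplectic t.ε t.χ →ₗ[ℂ] ((adelicDatum F V).Adelic → (Fin 2 → ℂ)),
              θ ≠ 0 ∧ (∀ v, θ v ∈ holCotForms (archFactorOf F V)) ∧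
                ∀ (g : ↥(HodgeCM.HermSpace3.adelicFin V)) (v : (datum413 hDel F V a₀ Φ i).omega t.μ t.isConjugateSymplectic t.ε t.χ),
                  θ (rhoTriple (datum413 hDel F V a₀ Φ i) t g v) = rightRep F V g (θ v)) ∨
        (∀ (t : (datum413 hDel F V a₀ Φ i).Triple), t.HasWeightOne → t.IsAdmissible → ι₁ ∉ t.cmType.1 →
            ∃ θ : (datum413 hDel F V a₀ Φ i).omega t.μ t.isConjugateSymplectic t.ε t.χ →ₗ[ℂ] ((adelicDatum F V).Adelic → (Fin 2 → ℂ)),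
              θ ≠ 0 ∧ (∀ v, θ v ∈ holCotForms (archFactorOf F V)) ∧
                ∀ (g : ↥(HodgeCM.HermSpace3.adelicFin V)) (v : (datum413 hDel F V a₀ Φ i).omega t.μ t.isConjugateSymplectic t.ε t.χ),
                  θ (rhoTriple (datum413 hDel F V a₀ Φ i) t g v) = rightRep F V g (θ v))

/-! ## §4  The heads as hypotheses-explicit theorems (kernel-checked, no `sorry` in this module) -/

end Summit.HodgeConjecture.HodgeConjecture.Cruxes.H413.SpectrumInterfaces
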